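import Summits.QuantumFields.BalabanUV.Beta.EriceRemainderEnclosureHistoryAutonomyComparisonPrinciple
import Summits.QuantumFields.BalabanUV.Beta.EriceRemainderEnclosureHistoryAutonomyMonotone

/-!
# EriceRemainderEnclosureHistoryAutonomyComparisonAffineProfile — (E58b) MEMORIES DOMINATED BY AN AFFINE PROFILE OF SEVERAL AGES: `B` isotone with floor
# `b > 0`, `Σ_{k<K} L_k·u_k ≤ B u`, and `B u − B u′ ≤ Σ_{k<K} L_k·(u_k − u′_k)` for `u′ ≤ u` at fixed newest entry (e.g. `b + c·u_0² + Σ_k L_k·u_k`) — a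
# TRAJECTORY-FREE PROFILE CONDITION for comparison at ANY size: **`Σ_{j<K} L_j ∕ P_j ≤ 2`, `P_j = Σ_{k<K} L_k·√(j∕(j+k))`**; under it every `B′ ≥ B` with a
# zeroth moment and an ISOTONE excess has `h′ ≤ h` at every scale from every pin (`le_of_isotone_excess_dom_profile`, `le_of_isotone_excess_affine_profile`)

Cell `pub-balaban`, β-function sub-cell, BINDER row D4 «RemainderConst leaves for Bałaban's split» (`HOME/BINDER-OWNERS.md`; owner lineage `b2b-balaban-beta-an4`;
this file by co-owner #2 lineage `b2b-balaban-beta-d4-p2`, generation 51), β-FLOW TEAM duty (1), FREEZE (0) honoured (def-free; (E58a)'s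
`le_of_isotone_excess_of_step`, (E41)'s `affine_monotone` ∕ `affine_floor` ∕ `affine_zerothMoment` (the displayed lambda term `fun u ↦ b + Σ_{k<K} L_k·u_k`),
(E49j)'s `excess_shift_le`, (E48a)'s `strictAnti_of_memFlow`, node U2's `invSq_eq_of_memFlow` ∕ `drive` ∕ `seqBox_shift` ∕ `Sharpness.abs_sub_le_half_cube_mul`
BY NAME; nothing restated).  Sequel of (E57a)∕(E57b) `…ComparisonAffine(Markov)` (ONE affine age, any size: acceleration lemma `M·K·h(K)³ ≤ 2`) and answer
to the first half of the question left there and in `HOME/b2b-balaban-beta-d4-p2/g46/E50a-DOSSIER.md` («several affine ages at any size?»); corollaries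
(windows of factor `3`, Markov-dominated profiles, the two-loop-shaped example) in the sequel (E58c) `…ComparisonAffineProfileEnd`.

HONEST FRAMING (page 1, verbatim and binding).  *"Discharging BetaPertH makes Bałaban's UV stability UNCONDITIONAL — a real constructive-QFT result; it is
NOT the continuum limit and NOT the Clay problem."*  THIS FILE DISCHARGES NOTHING OF THE KIND.  Elementary real analysis about ABSTRACT functionals on a box
]0,γ]^ℕ with displayed signs, domination and moduli — hypotheses of a census, not facts; the form, signs and moments of Bałaban's (1.22) limit functional
(in particular its age profile) are NOT PRINTED ([I] p. 298; GAPS G-t4-U2-1∕-2) and NOT asserted.  Row D4 class UNCHANGED (critical-path width 0; instance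
0∕1; D4 DISCHARGE NO DATE).  HONEST DEPENDENCY: continuum YM on T⁴ ⇐ BetaPertH ∧ nine spine estimates (0/9 proved); BetaPertH ⇐ (D1) ∧ (D4) ∧ CAP+tail;
G-an2-4 gates asym, D1 and NE2/3/4.

THE POINT (census sense (α); the COMPARISON column).  By (E58a) comparison at any size reduces to THE STEP: under comparison from a pin, the memory's DROP
between the two trajectories — here `B h − B h′ ≤ Σ_k L_k·(h_k − h′_k)` — is at most the excess `η = (B′ − B)(h′)`.  The levels differ by at most `k·η` at
scale `k`, so the drop is at most `(η∕2)·Q` with the LEVEL WEIGHT **`Q = Σ_k L_k·k·h_k³`** of the unperturbed trajectory (§3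
`effective_le_of_family_le_at_dom_of_weight`: `Q ≤ 2` suffices).  §2 bounds `Q` WITHOUT the trajectory: the increments `B(h(l+1+·))` of ANY isotone memory are
non-increasing along its (decreasing) solutions, so the levels `a_j = 1∕h_j²` are CONCAVE in the scale — **`j·a_{j+k} ≤ (j+k)·a_j`** (`mul_invSq_add_le`), i.e.
the reads obey **`h_{j+k} ≥ √(j∕(j+k))·h_j`** (`mul_sqrt_le_read`) — and domination gives `a_j ≥ j·Σ_k L_k·h_{j+k}` (`mul_read_le_invSq_of_dom`); together
**`L_j·j·h_j³ ≤ L_j ∕ P_j`**, `P_j = Σ_k L_k·√(j∕(j+k))` (`weight_le_profile`) and **`Q ≤ Σ_{j<K} L_j ∕ P_j`** (`weightSum_le_profileSum`; the `j = 0` summand is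
`0` on both sides — a Markov weight `L_0` carries no level weight but ENLARGES every `P_j` by `L_0`).  Hence comparison at any size under the PROFILE CONDITION
**`Σ_j L_j ∕ P_j ≤ 2`** (§4): ONE age gives `√2` ((E57a)∕(E57b) recovered with their slack); (E58c) lists the classes it covers (all ages within a factor `3`;
`Σ_k L_k ≤ 3·L_0`; numerically every uniform window `(M∕K)·Σ_{1≤k≤K} u_k`, `Σ_j L_j∕P_j ↑ ≈ 1.65`).  WHAT IS NOT CLAIMED, AND WHY THE GENERAL QUESTION STAYS OPEN
(`HOME/…/g51/e58/`): the condition is sufficient, not necessary; the weight `Q` itself is NOT bounded over all profiles — for two ages `1 ≪ ℓ` with strengths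
`M_ℓ∕M_1 ≈ ℓ^{1∕6}` each age dominates the drive at its own scale and `Q → 2·q⋆` (`q⋆ ≈ 1.35` the one-age supremum; `Q = 1.69` measured at `ℓ = 256`), `n`
hyper-separated ages give `≈ n·q⋆` — so NO bookkeeping by level weights settles all affine memories; the true linear response of the step (`step_lr.py`,
`adversarial.py`: drop∕excess over all front-loaded excess profiles) stays `≤ 0.53` up to separation `256`, because the drops at intermediate scales retard the
perturbed levels (time-shift picture: `δ_n ≈ ¾·n·η`; in the continuum limit the step is the sign of a one-sided derivative and holds identically, the defect
is a lattice effect of the YOUNG ages) — comparison for ALL affine memories at any size remains OPEN (conjectured TRUE).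

WHAT IS PROVED ([folklore]; 0 `def`, 0 sorry).  §1 `increment_anti` (isotone memory: level increments non-increasing).  §2 **`mul_invSq_add_le`** (levels concave),
**`mul_sqrt_le_read`**, **`mul_read_le_invSq_of_dom`**, `profile_pos`, **`weight_le_profile`**, **`weightSum_le_profileSum`**.  §3
**`effective_le_of_family_le_at_dom_of_weight`**, `effective_le_of_family_le_at_dom_of_profile`.  §4 **`le_of_isotone_excess_dom_profile`**,
**`le_of_isotone_excess_affine_profile`**.
-/
noncomputable section
open Finset Set

namespace Summit.QuantumFields.BalabanUV.Beta.EriceRemainderEnclosureHistoryAutonomyComparisonAffineProfile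

open Literature.MathematicalPhysics.QuantumFieldTheory.Balaban1983to89
open Literature.MathematicalPhysics.QuantumFieldTheory.Balaban1983to89.T4BetaStationary
open Literature.MathematicalPhysics.QuantumFieldTheory.Balaban1983to89.T4BetaFlowWellPosed
open Literature.MathematicalPhysics.QuantumFieldTheory.Balaban1983to89.T4BetaFlowWellPosed.Sharpness (abs_sub_le_half_cube_mul)
open Summit.QuantumFields.BalabanUV.Beta.EriceRemainderEnclosureHistoryAutonomyOrder (strictAnti_of_memFlow)
open Summit.QuantumFields.BalabanUV.Beta.EriceRemainderEnclosureHistoryAutonomyComparisonExcess (excess_shift_le)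
open Summit.QuantumFields.BalabanUV.Beta.EriceRemainderEnclosureHistoryAutonomyComparisonPrinciple (le_of_isotone_excess_of_step)
open Summit.QuantumFields.BalabanUV.Beta.EriceRemainderEnclosureHistoryAutonomyMonotone (affine_monotone affine_floor affine_zerothMoment)

variable {B B' : (ℕ → ℝ) → ℝ} {M M' γ b y : ℝ} {L : ℕ → ℝ} {K : ℕ} {h h' : ℕ → ℝ}

/-! ## §1 The level increments of an isotone memory are non-increasing along a box solution -/

/-- Along a box solution `h` of an ISOTONE memory `B` with floor `b > 0` from any pin, the level increments `1∕h(l+1)² − 1∕h(l)² = B(h(l+1+·))` are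
NON-INCREASING in the scale `l` (the trajectory decreases, the memory is isotone). [folklore] -/
theorem increment_anti (hmono : ∀ u v : ℕ → ℝ, SeqBox γ u → SeqBox γ v → (∀ j, u j ≤ v j) → B u ≤ B v) (hb : 0 < b)
    (hlo : ∀ u, SeqBox γ u → b ≤ B u) (hh : SeqBox γ h) (hf : MemFlow B y h) {l l' : ℕ} (hll' : l ≤ l') :
    B (fun j => h (l' + 1 + j)) ≤ B (fun j => h (l + 1 + j)) := by
  have hanti := (strictAnti_of_memFlow hb hlo hh hf).antitone
  exact hmono _ _ (seqBox_shift hh (l' + 1)) (seqBox_shift hh (l + 1)) fun j => hanti (by omega)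

/-! ## §2 Level geometry: concavity `j·a_{j+k} ≤ (j+k)·a_j`, reads `h_{j+k} ≥ √(j∕(j+k))·h_j`, domination `a_j ≥ j·Σ_k L_k·h_{j+k}`, the weight bound -/

/-- **THE LEVELS OF AN ISOTONE MEMORY ARE CONCAVE IN THE SCALE**: `j·(1∕h(j+k)²) ≤ (j+k)·(1∕h(j)²)` along every box solution from every pin `y > 0` —
the `k` increments after scale `j` are each at most every increment before scale `j`, whose sum is at most the level at `j`. [folklore] -/
theorem mul_invSq_add_le (hmono : ∀ u v : ℕ → ℝ, SeqBox γ u → SeqBox γ v → (∀ j, u j ≤ v j) → B u ≤ B v) (hb : 0 < b)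
    (hlo : ∀ u, SeqBox γ u → b ≤ B u) (hy : 0 < y) (hh : SeqBox γ h) (hf : MemFlow B y h) (j k : ℕ) :
    (j : ℝ) * (1 / h (j + k) ^ 2) ≤ ((j : ℝ) + k) * (1 / h j ^ 2) := by
  have ejk : 1 / h (j + k) ^ 2 = 1 / y ^ 2 + drive B h (j + k) := invSq_eq_of_memFlow hf (j + k)
  have ej : 1 / h j ^ 2 = 1 / y ^ 2 + drive B h j := invSq_eq_of_memFlow hf j
  have hsplit : drive B h (j + k) = drive B h j + ∑ i ∈ range k, B (fun n => h (j + i + 1 + n)) := by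
    unfold drive; rw [sum_range_add]
  -- each late increment is at most each early increment
  have hcmp : ∀ l ∈ range j, ∑ i ∈ range k, B (fun n => h (j + i + 1 + n)) ≤ (k : ℝ) * B (fun n => h (l + 1 + n)) := by
    intro l hl
    have hl' : l < j := mem_range.mp hl
    have : ∑ i ∈ range k, B (fun n => h (j + i + 1 + n)) ≤ ∑ _i ∈ range k, B (fun n => h (l + 1 + n)) :=
      sum_le_sum fun i _ => increment_anti hmono hb hlo hh hf (by omega)
    rwa [sum_const, card_range, nsmul_eq_mul] at this
  have hsum := sum_le_sum hcmp
  rw [sum_const, card_range, nsmul_eq_mul, ← mul_sum] at hsum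
  have hsum' : (j : ℝ) * ∑ i ∈ range k, B (fun n => h (j + i + 1 + n)) ≤ (k : ℝ) * drive B h j := by
    unfold drive; exact hsum
  -- j·(late part) ≤ k·(drive up to j) ≤ k·(level at j)
  have hy2 : 0 ≤ 1 / y ^ 2 := by positivity
  have hk0 : (0 : ℝ) ≤ k := Nat.cast_nonneg k
  have hky : 0 ≤ (k : ℝ) * (1 / y ^ 2) := mul_nonneg hk0 hy2
  rw [ejk, hsplit, ej]
  linarith [hsum', hky]

/-- **THE READS OF AN ISOTONE MEMORY OBEY `√(j∕(j+k))·h(j) ≤ h(j+k)`** (square root of the concavity inequality). [folklore] -/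
theorem mul_sqrt_le_read (hmono : ∀ u v : ℕ → ℝ, SeqBox γ u → SeqBox γ v → (∀ j, u j ≤ v j) → B u ≤ B v) (hb : 0 < b)
    (hlo : ∀ u, SeqBox γ u → b ≤ B u) (hy : 0 < y) (hh : SeqBox γ h) (hf : MemFlow B y h) (j k : ℕ) :
    Real.sqrt ((j : ℝ) / ((j : ℝ) + k)) * h j ≤ h (j + k) := by
  have hc := mul_invSq_add_le hmono hb hlo hy hh hf j k
  have hj := (hh j).1
  have hjk := (hh (j + k)).1
  rcases Nat.eq_zero_or_pos j with rfl | hjpos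
  · simp only [Nat.cast_zero, zero_div, Real.sqrt_zero, zero_mul]; exact hjk.le
  have hjr : (0 : ℝ) < j := by exact_mod_cast hjpos
  have hden : (0 : ℝ) < (j : ℝ) + k := by positivity
  -- h j² · j/(j+k) ≤ h (j+k)²
  have hsq : (j : ℝ) / ((j : ℝ) + k) * h j ^ 2 ≤ h (j + k) ^ 2 := by
    rw [div_mul_eq_mul_div, div_le_iff₀ hden]
    have e1 : (j : ℝ) * (1 / h (j + k) ^ 2) * (h (j + k) ^ 2 * h j ^ 2) = (j : ℝ) * h j ^ 2 := by
      field_simp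
    have e2 : ((j : ℝ) + k) * (1 / h j ^ 2) * (h (j + k) ^ 2 * h j ^ 2) = ((j : ℝ) + k) * h (j + k) ^ 2 := by
      field_simp
    have := mul_le_mul_of_nonneg_right hc (by positivity : (0 : ℝ) ≤ h (j + k) ^ 2 * h j ^ 2)
    rw [e1, e2] at this
    linarith
  have h1 : Real.sqrt ((j : ℝ) / ((j : ℝ) + k) * h j ^ 2) ≤ Real.sqrt (h (j + k) ^ 2) := Real.sqrt_le_sqrt hsq
  rwa [Real.sqrt_mul (div_nonneg hjr.le hden.le), Real.sqrt_sq hj.le, Real.sqrt_sq hjk.le] at h1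

/-- THE DOMINATING PROFILE DRIVES THE LEVELS: `B` isotone with floor `b > 0` and `Σ_{k<K} L_k·u_k ≤ B u` on the box (`L ≥ 0`); then along every box
solution from every pin `j·Σ_k L_k·h(j+k) ≤ 1∕h(j)²` (each of the `j` increments before scale `j` reads couplings at least `h(j+k)` at age `k`). [folklore] -/
theorem mul_read_le_invSq_of_dom (hmono : ∀ u v : ℕ → ℝ, SeqBox γ u → SeqBox γ v → (∀ j, u j ≤ v j) → B u ≤ B v)
    (hL : ∀ k, 0 ≤ L k) (hb : 0 < b) (hlo : ∀ u, SeqBox γ u → b ≤ B u) (hdom : ∀ u, SeqBox γ u → ∑ k ∈ range K, L k * u k ≤ B u)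
    (hy : 0 < y) (hh : SeqBox γ h) (hf : MemFlow B y h) (j : ℕ) :
    (j : ℝ) * ∑ k ∈ range K, L k * h (j + k) ≤ 1 / h j ^ 2 := by
  have _ := hmono
  have hanti := (strictAnti_of_memFlow hb hlo hh hf).antitone
  rw [invSq_eq_of_memFlow hf j]
  unfold drive
  have hterm : ∀ l ∈ range j, ∑ k ∈ range K, L k * h (j + k) ≤ B (fun i => h (l + 1 + i)) := by
    intro l hl
    have hl' : l < j := mem_range.mp hl
    have hs : ∑ k ∈ range K, L k * h (j + k) ≤ ∑ k ∈ range K, L k * h (l + 1 + k) :=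
      sum_le_sum fun k _ => mul_le_mul_of_nonneg_left (hanti (by omega)) (hL k)
    exact hs.trans (hdom _ (seqBox_shift hh (l + 1)))
  have hsum := sum_le_sum hterm
  rw [sum_const, card_range, nsmul_eq_mul] at hsum
  have : 0 < 1 / y ^ 2 := by positivity
  linarith

/-- The profile sum `P_j = Σ_k L_k·√(j∕(j+k))` is positive as soon as `j ≥ 1` and `L_j > 0` (`j < K`). [folklore] -/
theorem profile_pos (hL : ∀ k, 0 ≤ L k) {j : ℕ} (hjK : j ∈ range K) (hj : 1 ≤ j) (hLj : 0 < L j) :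
    0 < ∑ k ∈ range K, L k * Real.sqrt ((j : ℝ) / ((j : ℝ) + k)) := by
  have hjr : (0 : ℝ) < j := by exact_mod_cast hj
  refine lt_of_lt_of_le ?_ (single_le_sum (f := fun k => L k * Real.sqrt ((j : ℝ) / ((j : ℝ) + k)))
    (fun k _ => mul_nonneg (hL k) (Real.sqrt_nonneg _)) hjK)
  exact mul_pos hLj (Real.sqrt_pos.mpr (div_pos hjr (by positivity)))

/-- **THE WEIGHT OF EACH AGE IS BOUNDED BY THE PROFILE**: `L_j·j·h(j)³ ≤ L_j ∕ P_j`, `P_j = Σ_{k<K} L_k·√(j∕(j+k))`, along EVERY box solution from EVERY pin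
of an isotone memory with floor dominated by the profile `L` — WHATEVER the sizes (for `j = 0` both sides vanish: `P_0 = 0` and Lean's `x∕0 = 0`; for
`L_j = 0` likewise).  From `1∕h_j² ≥ j·Σ_k L_k·h_{j+k} ≥ j·h_j·P_j`. [folklore] -/
theorem weight_le_profile (hmono : ∀ u v : ℕ → ℝ, SeqBox γ u → SeqBox γ v → (∀ j, u j ≤ v j) → B u ≤ B v)
    (hL : ∀ k, 0 ≤ L k) (hb : 0 < b) (hlo : ∀ u, SeqBox γ u → b ≤ B u) (hdom : ∀ u, SeqBox γ u → ∑ k ∈ range K, L k * u k ≤ B u)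
    (hy : 0 < y) (hh : SeqBox γ h) (hf : MemFlow B y h) {j : ℕ} (hjK : j ∈ range K) :
    L j * j * h j ^ 3 ≤ L j / ∑ k ∈ range K, L k * Real.sqrt ((j : ℝ) / ((j : ℝ) + k)) := by
  have hj := (hh j).1
  rcases Nat.eq_zero_or_pos j with rfl | hjpos
  · have hP0 : ∑ k ∈ range K, L k * Real.sqrt (((0 : ℕ) : ℝ) / (((0 : ℕ) : ℝ) + k)) = 0 :=
      sum_eq_zero fun k _ => by simp
    rw [hP0]; simp
  rcases (hL j).eq_or_lt with hLj | hLj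
  · rw [← hLj]; simp
  have hP := profile_pos hL hjK hjpos hLj
  set P := ∑ k ∈ range K, L k * Real.sqrt ((j : ℝ) / ((j : ℝ) + k)) with hP_def
  -- h j · P ≤ Σ_k L_k h(j+k) and j · (that) ≤ 1 / h j²
  have hread : h j * P ≤ ∑ k ∈ range K, L k * h (j + k) := by
    rw [hP_def, mul_sum]
    exact sum_le_sum fun k _ => by
      have := mul_sqrt_le_read hmono hb hlo hy hh hf j k
      calc h j * (L k * Real.sqrt ((j : ℝ) / ((j : ℝ) + k))) = L k * (Real.sqrt ((j : ℝ) / ((j : ℝ) + k)) * h j) := by ring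
        _ ≤ L k * h (j + k) := mul_le_mul_of_nonneg_left this (hL k)
  have hlev := mul_read_le_invSq_of_dom hmono hL hb hlo hdom hy hh hf j
  have hjr : (0 : ℝ) ≤ j := Nat.cast_nonneg j
  have hkey : (j : ℝ) * (h j * P) ≤ 1 / h j ^ 2 := (mul_le_mul_of_nonneg_left hread hjr).trans hlev
  rw [le_div_iff₀ hP]
  have h3 : (j : ℝ) * h j ^ 3 * P ≤ 1 := by
    have := mul_le_mul_of_nonneg_right hkey (sq_nonneg (h j))
    rw [one_div_mul_cancel (by positivity)] at this
    calc (j : ℝ) * h j ^ 3 * P = (j : ℝ) * (h j * P) * h j ^ 2 := by ring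
      _ ≤ 1 := this
  calc L j * j * h j ^ 3 * P = L j * ((j : ℝ) * h j ^ 3 * P) := by ring
    _ ≤ L j * 1 := mul_le_mul_of_nonneg_left h3 hLj.le
    _ = L j := mul_one _

/-- **THE LEVEL WEIGHT IS BOUNDED BY THE PROFILE SUM**: `Q = Σ_{j<K} L_j·j·h(j)³ ≤ Σ_{j<K} L_j ∕ P_j` along every box solution from every pin — a bound
by the profile `L` ALONE (no `b`, no pin, no `γ`, no size). [folklore] -/
theorem weightSum_le_profileSum (hmono : ∀ u v : ℕ → ℝ, SeqBox γ u → SeqBox γ v → (∀ j, u j ≤ v j) → B u ≤ B v)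
    (hL : ∀ k, 0 ≤ L k) (hb : 0 < b) (hlo : ∀ u, SeqBox γ u → b ≤ B u) (hdom : ∀ u, SeqBox γ u → ∑ k ∈ range K, L k * u k ≤ B u)
    (hy : 0 < y) (hh : SeqBox γ h) (hf : MemFlow B y h) :
    ∑ j ∈ range K, L j * j * h j ^ 3 ≤ ∑ j ∈ range K, L j / ∑ k ∈ range K, L k * Real.sqrt ((j : ℝ) / ((j : ℝ) + k)) :=
  sum_le_sum fun _ hj => weight_le_profile hmono hL hb hlo hdom hy hh hf hj

/-! ## §3 THE STEP: under comparison from the pin the drop is at most `(η∕2)·Q` -/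

/-- **THE STEP FROM THE LEVEL WEIGHT.**  `B` isotone with floor `b > 0`, Lipschitz ALONG THE PROFILE at fixed newest entry (`B u − B u′ ≤ Σ_{k<K} L_k·(u_k − u′_k)`
for `u′ ≤ u` with `u′_0 = u_0`, `L ≥ 0`); `B ≤ B′` on the box with ISOTONE excess; `h`, `h′` box solutions of `B`, `B′` from one pin `y` with `h′ ≤ h` at every
scale, and the level weight of `h` satisfies `Q = Σ_k L_k·k·h_k³ ≤ 2`.  Then `B h ≤ B′ h′`: the levels differ by at most `k·η` at scale `k` (`η = (B′ − B)(h′)`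
dominates the shifted excesses, the memory reads of `h′` are below those of `h`), so the drop is `≤ Σ_k L_k·(h_k³∕2)·k·η = (Q∕2)·η ≤ η`. [folklore] -/
theorem effective_le_of_family_le_at_dom_of_weight
    (hmono : ∀ u v : ℕ → ℝ, SeqBox γ u → SeqBox γ v → (∀ j, u j ≤ v j) → B u ≤ B v) (hL : ∀ k, 0 ≤ L k) (hb : 0 < b)
    (hlo : ∀ u, SeqBox γ u → b ≤ B u)
    (hdrop : ∀ u u' : ℕ → ℝ, SeqBox γ u → SeqBox γ u' → (∀ j, u' j ≤ u j) → u' 0 = u 0 → B u - B u' ≤ ∑ k ∈ range K, L k * (u k - u' k))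
    (hexc : ∀ u, SeqBox γ u → B u ≤ B' u)
    (hDmono : ∀ u v : ℕ → ℝ, SeqBox γ u → SeqBox γ v → (∀ j, u j ≤ v j) → B' u - B u ≤ B' v - B v)
    (hh : SeqBox γ h) (hf : MemFlow B y h) (hh' : SeqBox γ h') (hf' : MemFlow B' y h') (hle : ∀ j, h' j ≤ h j)
    (hQ : ∑ k ∈ range K, L k * k * h k ^ 3 ≤ 2) : B h ≤ B' h' := by
  have hlo' : ∀ u, SeqBox γ u → b ≤ B' u := fun u hu => (hlo u hu).trans (hexc u hu)
  have hanti' : Antitone h' := (strictAnti_of_memFlow hb hlo' hh' hf').antitone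
  set η : ℝ := B' h' - B h' with hη_def
  have hη0 : 0 ≤ η := by rw [hη_def]; linarith [hexc h' hh']
  have hηs : ∀ n, |B (fun j => h' (n + 1 + j)) - B' (fun j => h' (n + 1 + j))| ≤ η := excess_shift_le hexc hDmono hh' hanti'
  -- levels: 0 ≤ a′_k − a_k ≤ k·η at every scale k
  have hlev : ∀ k : ℕ, 1 / h' k ^ 2 - 1 / h k ^ 2 ≤ (k : ℝ) * η := by
    intro k
    rw [invSq_eq_of_memFlow hf k, invSq_eq_of_memFlow hf' k,
      show (1:ℝ) / y ^ 2 + drive B' h' k - (1 / y ^ 2 + drive B h k) = drive B' h' k - drive B h k by ring]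
    unfold drive
    rw [← sum_sub_distrib]
    calc ∑ l ∈ range k, (B' (fun i => h' (l + 1 + i)) - B (fun i => h (l + 1 + i)))
        ≤ ∑ _l ∈ range k, η := sum_le_sum fun l _ => by
          have e1 := (abs_le.mp (hηs l)).1
          have e2 := hmono _ _ (seqBox_shift hh' (l + 1)) (seqBox_shift hh (l + 1)) fun i => hle (l + 1 + i)
          linarith
      _ = (k : ℝ) * η := by rw [sum_const, card_range, nsmul_eq_mul]
  have hlev0 : ∀ k : ℕ, 0 ≤ 1 / h' k ^ 2 - 1 / h k ^ 2 := fun k =>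
    sub_nonneg.mpr (one_div_le_one_div_of_le (pow_pos (hh' k).1 2) (pow_le_pow_left₀ (hh' k).1.le (hle k) 2))
  -- the gap at scale k: h_k − h′_k ≤ (h_k³/2)·k·η
  have hgap : ∀ k : ℕ, h k - h' k ≤ h k ^ 3 / 2 * ((k : ℝ) * η) := by
    intro k
    have hw := abs_sub_le_half_cube_mul (hh k).1 (hh' k).1 le_rfl (hle k)
    have habs : |1 / h k ^ 2 - 1 / h' k ^ 2| ≤ (k : ℝ) * η := by
      rw [abs_sub_comm, abs_of_nonneg (hlev0 k)]; exact hlev k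
    exact (le_abs_self _).trans (hw.trans (mul_le_mul_of_nonneg_left habs (by have := (hh k).1; positivity)))
  -- the drop B h − B h′ ≤ Σ_k L_k (h_k − h′_k) ≤ (Q/2)·η ≤ η
  have hdrop' : B h - B h' ≤ η := by
    have h0 : h' 0 = h 0 := by rw [hf.1, hf'.1]
    calc B h - B h' ≤ ∑ k ∈ range K, L k * (h k - h' k) := hdrop h h' hh hh' hle h0
      _ ≤ ∑ k ∈ range K, L k * (h k ^ 3 / 2 * ((k : ℝ) * η)) := sum_le_sum fun k _ => mul_le_mul_of_nonneg_left (hgap k) (hL k)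
      _ = (∑ k ∈ range K, L k * k * h k ^ 3) / 2 * η := by rw [sum_div, sum_mul]; exact sum_congr rfl fun k _ => by ring
      _ ≤ 2 / 2 * η := mul_le_mul_of_nonneg_right (div_le_div_of_nonneg_right hQ zero_le_two) hη0
      _ = η := by ring
  rw [hη_def] at hdrop'
  linarith

/-- **THE STEP FROM THE PROFILE CONDITION** `Σ_{j<K} L_j ∕ P_j ≤ 2` (trajectory-free), for `B` isotone with floor, DOMINATED by the profile
(`Σ_k L_k·u_k ≤ B u`) and Lipschitz along it at fixed newest entry. [folklore] -/
theorem effective_le_of_family_le_at_dom_of_profile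
    (hmono : ∀ u v : ℕ → ℝ, SeqBox γ u → SeqBox γ v → (∀ j, u j ≤ v j) → B u ≤ B v) (hL : ∀ k, 0 ≤ L k) (hb : 0 < b)
    (hlo : ∀ u, SeqBox γ u → b ≤ B u) (hdom : ∀ u, SeqBox γ u → ∑ k ∈ range K, L k * u k ≤ B u)
    (hdrop : ∀ u u' : ℕ → ℝ, SeqBox γ u → SeqBox γ u' → (∀ j, u' j ≤ u j) → u' 0 = u 0 → B u - B u' ≤ ∑ k ∈ range K, L k * (u k - u' k))
    (hP : ∑ j ∈ range K, L j / ∑ k ∈ range K, L k * Real.sqrt ((j : ℝ) / ((j : ℝ) + k)) ≤ 2)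
    (hexc : ∀ u, SeqBox γ u → B u ≤ B' u)
    (hDmono : ∀ u v : ℕ → ℝ, SeqBox γ u → SeqBox γ v → (∀ j, u j ≤ v j) → B' u - B u ≤ B' v - B v)
    (hy : 0 < y) (hh : SeqBox γ h) (hf : MemFlow B y h) (hh' : SeqBox γ h') (hf' : MemFlow B' y h') (hle : ∀ j, h' j ≤ h j) :
    B h ≤ B' h' :=
  effective_le_of_family_le_at_dom_of_weight hmono hL hb hlo hdrop hexc hDmono hh hf hh' hf' hle
    ((weightSum_le_profileSum hmono hL hb hlo hdom hy hh hf).trans hP)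

/-! ## §4 ENDs: comparison at any size under the profile condition — the dominated class and the affine memory -/

/-- **MEMORIES DOMINATED BY AN AFFINE PROFILE COMPARE AT ANY SIZE UNDER THE PROFILE CONDITION.**  `B` ISOTONE on ]0,γ] with floor `b > 0` and zeroth moment
`M ≥ 0` (ANY size), DOMINATED by the profile `L ≥ 0` (`Σ_{k<K} L_k·u_k ≤ B u`) and Lipschitz along it at fixed newest entry (`B u − B u′ ≤ Σ_k L_k·(u_k − u′_k)`
for `u′ ≤ u`, `u′_0 = u_0`), with **`Σ_{j<K} L_j ∕ P_j ≤ 2`**, `P_j = Σ_{k<K} L_k·√(j∕(j+k))` (the `j = 0` summand reads `0`); `B′` with zeroth moment `M′ ≥ 0`,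
`B ≤ B′` on the box, the EXCESS `B′ − B` ISOTONE; `h`, `h′` ANY box solutions of `B`, `B′` from one pin `p ∈ ]0,γ]`.  Then `h′ ≤ h` at EVERY scale. [folklore] -/
theorem le_of_isotone_excess_dom_profile {p : ℝ}
    (hmono : ∀ u v : ℕ → ℝ, SeqBox γ u → SeqBox γ v → (∀ j, u j ≤ v j) → B u ≤ B v)
    (hB : ∀ u u' : ℕ → ℝ, SeqBox γ u → SeqBox γ u' → ∀ D : ℝ, (∀ j, |u j - u' j| ≤ D) → |B u - B u'| ≤ M * D) (hM : 0 ≤ M)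
    (hL : ∀ k, 0 ≤ L k) (hb : 0 < b) (hlo : ∀ u, SeqBox γ u → b ≤ B u) (hdom : ∀ u, SeqBox γ u → ∑ k ∈ range K, L k * u k ≤ B u)
    (hdrop : ∀ u u' : ℕ → ℝ, SeqBox γ u → SeqBox γ u' → (∀ j, u' j ≤ u j) → u' 0 = u 0 → B u - B u' ≤ ∑ k ∈ range K, L k * (u k - u' k))
    (hP : ∑ j ∈ range K, L j / ∑ k ∈ range K, L k * Real.sqrt ((j : ℝ) / ((j : ℝ) + k)) ≤ 2)
    (hB' : ∀ u u' : ℕ → ℝ, SeqBox γ u → SeqBox γ u' → ∀ D : ℝ, (∀ j, |u j - u' j| ≤ D) → |B' u - B' u'| ≤ M' * D) (hM' : 0 ≤ M')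
    (hexc : ∀ u, SeqBox γ u → B u ≤ B' u)
    (hDmono : ∀ u v : ℕ → ℝ, SeqBox γ u → SeqBox γ v → (∀ j, u j ≤ v j) → B' u - B u ≤ B' v - B v)
    (hp : 0 < p) (hpγ : p ≤ γ) (hh : SeqBox γ h) (hf : MemFlow B p h) (hh' : SeqBox γ h') (hf' : MemFlow B' p h') (j : ℕ) :
    h' j ≤ h j :=
  le_of_isotone_excess_of_step hmono hB hM hb hlo hB' hM' hexc hDmono
    (fun _ hy _ _ _ hu hfu hu' hfu' hle =>
      effective_le_of_family_le_at_dom_of_profile hmono hL hb hlo hdom hdrop hP hexc hDmono hy hu hfu hu' hfu' hle)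
    hp hpγ hh hf hh' hf' j

/-- **THE AFFINE MEMORY OF SEVERAL AGES `B(u) = b + Σ_{k<K} L_k·u_k` COMPARES AT ANY SIZE UNDER THE PROFILE CONDITION** (`b > 0`, `L_k ≥ 0` of ANY sizes, any
range `K`; `Σ_{j<K} L_j ∕ P_j ≤ 2`): for every `B′ ≥ B` with a zeroth moment and an ISOTONE excess, ANY box solutions from one pin satisfy `h′ ≤ h` at every
scale.  ONE age `K₀ ≥ 1` gives `Σ_j L_j∕P_j = √2` — (E57a) `le_of_isotone_excess_affine` recovered. [folklore] -/
theorem le_of_isotone_excess_affine_profile {p : ℝ} (hL : ∀ k, 0 ≤ L k) (hb : 0 < b)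
    (hP : ∑ j ∈ range K, L j / ∑ k ∈ range K, L k * Real.sqrt ((j : ℝ) / ((j : ℝ) + k)) ≤ 2)
    (hB' : ∀ u u' : ℕ → ℝ, SeqBox γ u → SeqBox γ u' → ∀ D : ℝ, (∀ j, |u j - u' j| ≤ D) → |B' u - B' u'| ≤ M' * D) (hM' : 0 ≤ M')
    (hexc : ∀ u, SeqBox γ u → (fun u : ℕ → ℝ => b + ∑ k ∈ range K, L k * u k) u ≤ B' u)
    (hDmono : ∀ u v : ℕ → ℝ, SeqBox γ u → SeqBox γ v → (∀ j, u j ≤ v j) →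
      B' u - (fun u : ℕ → ℝ => b + ∑ k ∈ range K, L k * u k) u ≤ B' v - (fun u : ℕ → ℝ => b + ∑ k ∈ range K, L k * u k) v)
    (hp : 0 < p) (hpγ : p ≤ γ) (hh : SeqBox γ h) (hf : MemFlow (fun u : ℕ → ℝ => b + ∑ k ∈ range K, L k * u k) p h)
    (hh' : SeqBox γ h') (hf' : MemFlow B' p h') (j : ℕ) : h' j ≤ h j := by
  refine le_of_isotone_excess_dom_profile (B := fun u : ℕ → ℝ => b + ∑ k ∈ range K, L k * u k) (affine_monotone hL)
    (affine_zerothMoment hL) (sum_nonneg fun k _ => hL k) hL hb (affine_floor hL) ?_ ?_ hP hB' hM' hexc hDmono hp hpγ hh hf hh' hf' j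
  · intro u _; linarith
  · intro u u' _ _ _ _
    rw [add_sub_add_left_eq_sub, ← sum_sub_distrib]
    exact le_of_eq (sum_congr rfl fun k _ => by ring)

end Summit.QuantumFields.BalabanUV.Beta.EriceRemainderEnclosureHistoryAutonomyComparisonAffineProfile

end
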